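import Summits.BirchSwinnertonDyer.BirchSwinnertonDyer.Theses.ByReductionTypeAtTwo
import Summits.BirchSwinnertonDyer.BirchSwinnertonDyer.Theses.TwoAdicConverse
import Summits.BirchSwinnertonDyer.BirchSwinnertonDyer.Theorems.ByReductionTypeAtTwoKatoFreeSandwichAssembly
import HarnessLib

/-!
# crux-triage r1 seat 1, GEN 12 — probe of the LANDED assembly p668589 against the ROUTE DECL by name

Question (joint sufficiency, by name): does the accepted helper
`KatoFreeSandwich.ordMissingLowerBoundAtTwo_of_published_of_lambdaHalf` conclude the ROUTE DECL
`Theses.ByReductionTypeAtTwo.OrdMissingLowerBoundAtTwo` (item 19577) from EXACTLY the three registered v12 stub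
TYPES {stub_pub, stub_gamma1Optimal, stub_lambdaHalf} (stated here as hypotheses, by name), with axioms ⊆ the trio?
No `sorry` in this file: every open input is a HYPOTHESIS.  BSD is not proved by any of this; 19577 is not closed.
-/

set_option autoImplicit false

open Literature.NumberTheory.EllipticCurves.ModularForms

namespace TriageR12ProbeAssembly

/-- The route decl of 19577 from the v12 stub types, via the landed assembly (p668589). -/
theorem routeDecl_of_v12_stubTypes
    (stub_pub :
      Summit.BirchSwinnertonDyer.BirchSwinnertonDyer.Theses.ByReductionTypeAtTwo.OrdPublishedInputsAtTwo ∧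
      Summit.BirchSwinnertonDyer.BirchSwinnertonDyer.Theses.ByReductionTypeAtTwo.OrdIsoPublishedInputsAtTwo ∧
      abbesUllmo_not_dvd_maninConstant_of_not_dvd_level)
    (stub_gamma1Optimal : exists_optimal_gamma1ParametrizationData)
    (stub_lambdaHalf : Summit.BirchSwinnertonDyer.BirchSwinnertonDyer.Theses.TwoAdicConverse.OrdLambdaHalfAtTwo) :
    Summit.BirchSwinnertonDyer.BirchSwinnertonDyer.Theses.ByReductionTypeAtTwo.OrdMissingLowerBoundAtTwo := by
  obtain ⟨hP, ⟨hC, -⟩, hAU⟩ := stub_pub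
  exact Summit.BirchSwinnertonDyer.BirchSwinnertonDyer.Theorems.KatoFreeSandwich.ordMissingLowerBoundAtTwo_of_published_of_lambdaHalf
    hP hC hAU stub_gamma1Optimal stub_lambdaHalf

/-- Same, with the five Literature-level inputs displayed separately (the K4 pen board's form
«19577 ⟸ PUB ∧ Cassels ∧ AU ∧ T2 ∧ 19556»). -/
theorem routeDecl_of_five_inputs
    (hPub : Literature.Uncategorized.OrdPublishedInputsAtTwo)
    (hCassels : WeierstrassCurve.bsdRHS_eq_of_isIsogenous)
    (hAU : abbesUllmo_not_dvd_maninConstant_of_not_dvd_level)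
    (hT2 : exists_optimal_gamma1ParametrizationData)
    (h19556 : Summit.BirchSwinnertonDyer.BirchSwinnertonDyer.Theorems.TwoAdicTwistConverse.OrdLambdaHalfAtTwo) :
    Summit.BirchSwinnertonDyer.BirchSwinnertonDyer.Theses.ByReductionTypeAtTwo.OrdMissingLowerBoundAtTwo :=
  Summit.BirchSwinnertonDyer.BirchSwinnertonDyer.Theorems.KatoFreeSandwich.ordMissingLowerBoundAtTwo_of_published_of_lambdaHalf
    hPub hCassels hAU hT2 h19556

#print axioms routeDecl_of_v12_stubTypes
#print axioms Summit.BirchSwinnertonDyer.BirchSwinnertonDyer.Theorems.KatoFreeSandwich.ordMissingLowerBoundAtTwo_of_published_of_lambdaHalf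

end TriageR12ProbeAssembly
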